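import Summits.Ventures.CertifiedManyBodySolver.Theorems.M3x2EdgeSplitSymReplayPackedCollectSort
import Mathlib.Algebra.BigOperators.Group.List.Basic
import HarnessLib

/-!
# SymReplay — THEORY OF THE PACKED COLLECTOR, part 2: `pcollect2 q` is the UNIQUE strictly sorted list with `q`'s word sums

(team lb-sym, cell hub-lb; hub-lb-sym-eng-4 g3, 2026-08-28; module 2 of 4 of lever (α-T); ADDITIVE on `…PackedCollectSort`.)

* (c) word sums `csum l w` and occurrence `occ l w` (permutation-invariant); `pmergeAdj` preserves both (`csum_pmergeAdj`,
  `occ_pmergeAdj`) and turns a sorted list into a STRICTLY sorted one (`pmergeAdj_strict`).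
* (d) `IsColl q l` («`l` is a collected form of `q`»: strictly sorted by word, same `occ`, same `csum`); `pcollect2_isColl`;
  membership in a strictly sorted list is decided by `occ`/`csum` (`mem_iff_of_strict`); uniqueness `eq_of_isColl` (Mathlib's
  `List.Pairwise.eq_of_mem_iff`) and **`eq_pcollect2_of_isColl : IsColl q l → l = pcollect2 q`** — the lemma through which any
  other collector executable is swapped in by LIST EQUALITY (`…PackedCollectT`).

HONEST FRAMING: list theory about an existing executable / an interpreted replay-COST lever; certifies nothing; no bound of
record moves; no summit or crux statement is proved here; nothing here predicts superconductivity.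
-/

namespace Summit.Ventures.CertifiedManyBodySolver.Theorems.SymReplay.PackedNF

open Summit.Ventures.CertifiedManyBodySolver.Theorems.SymReplay

/-! ##### (c) word sums, occurrence, and `pmergeAdj` -/

/-- **Word sum**: the total coefficient of the word `w` in `l`. -/
def csum (l : PPoly) (w : PWord) : ℚ := ((l.filter fun t => pwordEq t.2 w).map Prod.fst).sum

/-- **Occurrence**: the word `w` occurs in `l`. -/
def occ (l : PPoly) (w : PWord) : Bool := l.any fun t => pwordEq t.2 w

/-- `csum` on `nil`. -/
@[simp] theorem csum_nil (w : PWord) : csum [] w = 0 := rfl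

/-- `csum` on `cons`. -/
theorem csum_cons (t : ℚ × PWord) (l : PPoly) (w : PWord) :
    csum (t :: l) w = (if pwordEq t.2 w = true then t.1 else 0) + csum l w := by
  unfold csum
  rw [List.filter_cons]
  split_ifs with h
  · rw [List.map_cons, List.sum_cons]
  · rw [zero_add]

/-- `occ` on `nil`. -/
@[simp] theorem occ_nil (w : PWord) : occ [] w = false := rfl

/-- `occ` on `cons`. -/
theorem occ_cons (t : ℚ × PWord) (l : PPoly) (w : PWord) : occ (t :: l) w = (pwordEq t.2 w || occ l w) := by
  unfold occ; rw [List.any_cons]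

/-- `csum` is permutation-invariant. -/
theorem csum_perm {l₁ l₂ : PPoly} (h : l₁.Perm l₂) (w : PWord) : csum l₁ w = csum l₂ w := by
  unfold csum; exact ((h.filter _).map _).sum_eq

/-- `occ` is permutation-invariant. -/
theorem occ_perm {l₁ l₂ : PPoly} (h : l₁.Perm l₂) (w : PWord) : occ l₁ w = occ l₂ w := by
  unfold occ
  rw [Bool.eq_iff_iff, List.any_eq_true, List.any_eq_true]
  exact ⟨fun ⟨t, ht, e⟩ => ⟨t, h.mem_iff.1 ht, e⟩, fun ⟨t, ht, e⟩ => ⟨t, h.mem_iff.2 ht, e⟩⟩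

/-- Above every word of `l` ⇒ no occurrence. -/
theorem occ_eq_false_of_lt (w : PWord) : ∀ (l : PPoly), (∀ x ∈ l, pwordLt w x.2 = true) → occ l w = false
  | [], _ => rfl
  | x :: l, h => by
    rw [occ_cons, occ_eq_false_of_lt w l fun y hy => h y (List.mem_cons_of_mem _ hy), Bool.or_false,
      pwordEq_eq_false_iff]
    exact (ne_of_pwordLt (h x List.mem_cons_self)).symm

/-- Above every word of `l` ⇒ zero word sum. -/
theorem csum_eq_zero_of_lt (w : PWord) : ∀ (l : PPoly), (∀ x ∈ l, pwordLt w x.2 = true) → csum l w = 0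
  | [], _ => rfl
  | x :: l, h => by
    rw [csum_cons, csum_eq_zero_of_lt w l fun y hy => h y (List.mem_cons_of_mem _ hy), add_zero, if_neg]
    rw [pwordEq_eq_true_iff]
    exact (ne_of_pwordLt (h x List.mem_cons_self)).symm

/-- `pmergeAdj` on `cons`, by cases on the merged tail. -/
theorem pmergeAdj_cons (s : ℚ × PWord) (l : PPoly) :
    pmergeAdj (s :: l) = (match pmergeAdj l with
      | [] => [s]
      | t' :: rest' => if pwordEq s.2 t'.2 then (s.1 + t'.1, s.2) :: rest' else s :: t' :: rest') := rfl

/-- Every word of `pmergeAdj l` is a word of `l`. -/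
theorem mem_pmergeAdj_word : ∀ (l : PPoly), ∀ t ∈ pmergeAdj l, ∃ s ∈ l, s.2 = t.2
  | [], t, ht => by simp [pmergeAdj] at ht
  | s :: l, t, ht => by
    have ih : ∀ x ∈ pmergeAdj l, ∃ s' ∈ s :: l, s'.2 = x.2 := fun x hx => by
      obtain ⟨s', hs', e⟩ := mem_pmergeAdj_word l x hx
      exact ⟨s', List.mem_cons_of_mem _ hs', e⟩
    rw [pmergeAdj_cons] at ht
    cases hm : pmergeAdj l with
    | nil =>
      rw [hm] at ht
      simp only [List.mem_singleton] at ht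
      exact ⟨s, List.mem_cons_self, by rw [ht]⟩
    | cons t' rest' =>
      rw [hm] at ht ih
      simp only at ht
      split_ifs at ht with he
      · rcases List.mem_cons.1 ht with rfl | ht
        · exact ⟨s, List.mem_cons_self, rfl⟩
        · exact ih t (List.mem_cons_of_mem _ ht)
      · rcases List.mem_cons.1 ht with rfl | ht
        · exact ⟨_, List.mem_cons_self, rfl⟩
        · exact ih _ ht

/-- **`pmergeAdj` preserves word sums.** -/
theorem csum_pmergeAdj (w : PWord) : ∀ (l : PPoly), csum (pmergeAdj l) w = csum l w
  | [] => rfl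
  | s :: l => by
    have ih := csum_pmergeAdj w l
    rw [pmergeAdj_cons]
    cases hm : pmergeAdj l with
    | nil =>
      rw [hm] at ih
      show csum [s] w = csum (s :: l) w
      rw [csum_cons, csum_cons, ← ih]
    | cons t' rest' =>
      rw [hm] at ih
      show csum (if pwordEq s.2 t'.2 then (s.1 + t'.1, s.2) :: rest' else s :: t' :: rest') w = csum (s :: l) w
      by_cases he : pwordEq s.2 t'.2 = true
      · rw [if_pos he]
        obtain ⟨sc, sw⟩ := s
        obtain ⟨tc, tw⟩ := t'
        have hst : sw = tw := (pwordEq_eq_true_iff _ _).1 he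
        subst hst
        rw [csum_cons, csum_cons, ← ih, csum_cons]
        simp only
        split_ifs <;> ring
      · rw [if_neg he, csum_cons s (t' :: rest') w, csum_cons s l w, ih]

/-- **`pmergeAdj` preserves occurrence.** -/
theorem occ_pmergeAdj (w : PWord) : ∀ (l : PPoly), occ (pmergeAdj l) w = occ l w
  | [] => rfl
  | s :: l => by
    have ih := occ_pmergeAdj w l
    rw [pmergeAdj_cons, occ_cons]
    cases hm : pmergeAdj l with
    | nil =>
      rw [hm] at ih
      simp only
      rw [occ_cons, ← ih]
    | cons t' rest' =>
      rw [hm] at ih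
      simp only
      split_ifs with he
      · rw [occ_cons, ← ih, occ_cons]
        have hst : s.2 = t'.2 := (pwordEq_eq_true_iff _ _).1 he
        simp only [hst, ← Bool.or_assoc, Bool.or_self]
      · rw [occ_cons, ← ih]

/-- **`pmergeAdj` of a sorted list is strictly sorted.** -/
theorem pmergeAdj_strict : ∀ (l : PPoly), SortedP l → StrictP (pmergeAdj l)
  | [], _ => by simp [pmergeAdj, StrictP]
  | s :: l, h => by
    have hs : ∀ x ∈ l, ple s x = true := fun x hx => List.rel_of_pairwise_cons h hx
    have ih : StrictP (pmergeAdj l) := pmergeAdj_strict l (List.Pairwise.of_cons h)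
    rw [pmergeAdj_cons]
    cases hm : pmergeAdj l with
    | nil => simp [StrictP]
    | cons t' rest' =>
      rw [hm] at ih
      have ih' : ∀ x ∈ rest', pwordLt t'.2 x.2 = true := fun x hx => List.rel_of_pairwise_cons ih hx
      -- the head word of the merged tail is a word of `l`, hence not below `s`
      obtain ⟨s', hs', e⟩ := mem_pmergeAdj_word l t' (by rw [hm]; exact List.mem_cons_self)
      have hle : pwordLt t'.2 s.2 = false := by
        have := hs s' hs'; rw [ple, Bool.not_eq_true', e] at this; exact this
      simp only
      split_ifs with he
      · have hst : s.2 = t'.2 := (pwordEq_eq_true_iff _ _).1 he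
        refine List.Pairwise.cons (fun x hx => ?_) (List.Pairwise.of_cons ih)
        rw [hst]; exact ih' x hx
      · have hlt : pwordLt s.2 t'.2 = true := by
          rcases pwordLt_total s.2 t'.2 with h1 | h1 | h1
          · exact h1
          · exact absurd h1 ((pwordEq_eq_false_iff _ _).1 (Bool.eq_false_iff.2 he))
          · rw [hle] at h1; exact absurd h1 Bool.false_ne_true
        refine List.Pairwise.cons (fun x hx => ?_) ih
        rcases List.mem_cons.1 hx with rfl | hx
        · exact hlt
        · exact pwordLt_trans _ _ _ hlt (ih' x hx)

/-! ##### (d) collected forms and uniqueness -/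

/-- **`l` is a collected form of `q`**: strictly sorted by word, same occurring words, same word sums. -/
def IsColl (q l : PPoly) : Prop := StrictP l ∧ ∀ w, occ l w = occ q w ∧ csum l w = csum q w

/-- **The landed collector produces a collected form.** -/
theorem pcollect2_isColl (q : PPoly) : IsColl q (pcollect2 q) :=
  ⟨pmergeAdj_strict _ (psortW_sorted q), fun w =>
    ⟨(occ_pmergeAdj w _).trans (occ_perm (psortW_perm q) w), (csum_pmergeAdj w _).trans (csum_perm (psortW_perm q) w)⟩⟩

/-- **Membership in a strictly sorted list** is decided by occurrence and word sum. -/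
theorem mem_iff_of_strict : ∀ (l : PPoly), StrictP l → ∀ (t : ℚ × PWord), t ∈ l ↔ occ l t.2 = true ∧ csum l t.2 = t.1
  | [], _, t => by simp
  | s :: l, h, t => by
    have hs : ∀ x ∈ l, pwordLt s.2 x.2 = true := fun x hx => List.rel_of_pairwise_cons h hx
    have ih := mem_iff_of_strict l (List.Pairwise.of_cons h) t
    rw [List.mem_cons, occ_cons, csum_cons]
    by_cases hw : s.2 = t.2
    · have hocc : occ l t.2 = false := occ_eq_false_of_lt t.2 l (hw ▸ hs)
      have hcs : csum l t.2 = 0 := csum_eq_zero_of_lt t.2 l (hw ▸ hs)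
      have he : pwordEq s.2 t.2 = true := (pwordEq_eq_true_iff _ _).2 hw
      rw [he, if_pos rfl, hocc, hcs, add_zero, Bool.true_or]
      constructor
      · rintro (rfl | ht)
        · exact ⟨rfl, rfl⟩
        · exact absurd (ih.1 ht).1 (by rw [hocc]; exact Bool.false_ne_true)
      · rintro ⟨_, hc⟩
        exact Or.inl (Prod.ext hc.symm hw.symm)
    · have he : pwordEq s.2 t.2 = false := (pwordEq_eq_false_iff _ _).2 hw
      rw [he, Bool.false_or, if_neg Bool.false_ne_true, zero_add, ← ih]
      constructor
      · rintro (rfl | ht)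
        · exact absurd rfl hw
        · exact ht
      · exact Or.inr

/-- **Uniqueness of collected forms.** -/
theorem eq_of_isColl (q l₁ l₂ : PPoly) (h₁ : IsColl q l₁) (h₂ : IsColl q l₂) : l₁ = l₂ := by
  haveI : Std.Irrefl (fun a b : ℚ × PWord => pwordLt a.2 b.2 = true) :=
    ⟨fun a h => by rw [pwordLt_irrefl] at h; exact Bool.false_ne_true h⟩
  haveI : Std.Antisymm (fun a b : ℚ × PWord => pwordLt a.2 b.2 = true) :=
    ⟨fun a b h h' => by rw [pwordLt_asymm _ _ h] at h'; exact absurd h' Bool.false_ne_true⟩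
  refine List.Pairwise.eq_of_mem_iff h₁.1 h₂.1 fun t => ?_
  rw [mem_iff_of_strict l₁ h₁.1, mem_iff_of_strict l₂ h₂.1, (h₁.2 t.2).1, (h₁.2 t.2).2, (h₂.2 t.2).1, (h₂.2 t.2).2]

/-- **MAIN: a collected form of `q` IS `pcollect2 q`.**  (Module B's ordered-map collector lands through this.) -/
theorem eq_pcollect2_of_isColl (q l : PPoly) (h : IsColl q l) : l = pcollect2 q :=
  eq_of_isColl q l _ h (pcollect2_isColl q)

end Summit.Ventures.CertifiedManyBodySolver.Theorems.SymReplay.PackedNF
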